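import Summits.ABC.IUTFork.Cor312RamifiedPlaceData
import HarnessLib

/-!
# [IUTchIII] Cor. 3.12, Team R ramified-mover thread — the valuation of `ℚ(ζ₃)` at `(λ)`:
# parity, the max formula, boundedness of the swap, and the integer lattice

Proof-bearing companion of `Cor312RamifiedPlaceData.lean` (abc-iut cell, Cor. 3.12 STRATEGY
TEAM R, lead R1 = abc-iut-c312-14; the «ramified non-rational-multiple mover» thread of
`Cor312IdentifiedIndFixes` p418763, kit `Cor312IdentifiedMoverKit` p424851); TAKES NO SIDE on
[IUTchIII] Cor. 3.12. Classical algebraic number theory at the third cyclotomic field: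

* the place `v3 = (λ)` (`lamInt` is prime by Mathlib's `zeta_sub_one_prime'`) with
  `val3_lam_lt_one` and the PARITY source `val3_lam_sq` (`v(λ)² = v(3)`);
* `val3_intCast_eq_one` (`v(n) = 1` for `3 ∤ n`, by an explicit Bézout identity against
  `λ ∣ 3`), `val3_ratCast_exists` (`v(q) ∈ v(3)^ℤ`), and the PARITY LEMMA
  `val3_ratCast_ne_val3_lam`: `v(λ)` is the valuation of NO rational number — this is exactly
  where ramification enters;
* the ultrametric max formula `val3_add_eq_max` in the `{1, λ}` coordinates and the kit's
  boundedness hypothesis `val3_bound` (`v(λ)·v(sSwap x) ≤ v(x)`);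
* the integer lattice: `𝒪_{K₃} = ℤ[ζ₃] = ℤ ⊕ ℤλ` (`exists_int_coords`, via Mathlib's
  `isIntegralClosure_adjoin_singleton_of_prime`), hence the swap maps the image of `𝒪_{K₃}`
  into itself (`sSwap_image_int`) — the kit's lattice hypothesis.

Consumer: `Cor312IdentifiedRamifiedMover.lean` feeds these into the kit and derives the
`Real.ismDH` mover of the p418763 docstring signature. Every statement is about the third
cyclotomic field only; nothing here bears on the dispute. [folklore] throughout; standard axioms.
-/

noncomputable section

namespace Summit.ABC.IUTFork.RamifiedMover

open IsDedekindDomain IsDedekindDomain.HeightOneSpectrum NumberField Module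
open scoped Pointwise

/-! ## 3. The ramified place `v₃ = (λ)` and its valuation -/

/-- `ζ₃` as an algebraic integer. [folklore] -/
def zetaInt : 𝓞 K3 := zeta3_spec.toInteger

/-- `λ = ζ₃ − 1` as an algebraic integer. [folklore] -/
def lamInt : 𝓞 K3 := zetaInt - 1

/-- `lamInt` maps to `λ`. [folklore] -/
theorem algebraMap_lamInt : algebraMap (𝓞 K3) K3 lamInt = lam := by
  have h : algebraMap (𝓞 K3) K3 zetaInt = zeta3 := rfl
  rw [lamInt, map_sub, map_one, h, lam]

/-- `lamInt` maps to `λ` (coercion form). [folklore] -/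
theorem coe_lamInt : (lamInt : K3) = lam := algebraMap_lamInt

/-- `lamInt ≠ 0`. [folklore] -/
theorem lamInt_ne_zero : lamInt ≠ 0 := by
  intro h
  apply lam_ne_zero
  rw [← algebraMap_lamInt, h, map_zero]

/-- **`λ = ζ₃ − 1` is prime in `𝒪_{K₃}`** (Mathlib). [folklore] -/
theorem lamInt_prime : Prime lamInt := by
  haveI : Fact (Nat.Prime 3) := ⟨by norm_num⟩
  haveI := cycInst
  exact zeta3_spec.zeta_sub_one_prime'

/-- **The ramified place `v₃ = (λ)` of `K₃` above `3`.** [folklore] -/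
def v3 : HeightOneSpectrum (𝓞 K3) where
  asIdeal := Ideal.span {lamInt}
  isPrime := (Ideal.span_singleton_prime lamInt_ne_zero).mpr lamInt_prime
  ne_bot := by
    simp only [ne_eq, Ideal.span_singleton_eq_bot]
    exact lamInt_ne_zero

/-- `v₃(λ) < 1`: `λ` is `v₃`-small. [folklore] -/
theorem val3_lam_lt_one : v3.valuation K3 lam < 1 := by
  rw [← algebraMap_lamInt, valuation_of_algebraMap, intValuation_lt_one_iff_dvd]
  exact dvd_refl _

/-- Valuations of nonzero elements are nonzero. [folklore] -/
theorem val3_ne_zero {x : K3} (hx : x ≠ 0) : v3.valuation K3 x ≠ 0 := by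
  simpa using hx

/-- `v₃(ζ₃) = 1` (`ζ₃` is a root of unity). [folklore] -/
theorem val3_zeta : v3.valuation K3 zeta3 = 1 := by
  have h3 : v3.valuation K3 zeta3 ^ 3 = 1 := by
    rw [← map_pow, zeta3_pow_three, map_one]
  set x := v3.valuation K3 zeta3 with hx
  have hcube : x * (x * x) = 1 := by
    rw [show x * (x * x) = x ^ 3 by rw [pow_succ, pow_two, mul_comm (x * x) x], h3]
  rcases le_total x 1 with h | h
  · -- x ≤ 1: 1 = x³ ≤ x, so x = 1
    have hle : x * (x * x) ≤ x := by
      calc x * (x * x) ≤ x * (1 * 1) := mul_le_mul' le_rfl (mul_le_mul' h h)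
        _ = x := by rw [one_mul, mul_one]
    rw [hcube] at hle
    exact le_antisymm h hle
  · -- 1 ≤ x: x ≤ x³ = 1, so x = 1
    have hle : x ≤ x * (x * x) := by
      calc x = x * (1 * 1) := by rw [one_mul, mul_one]
        _ ≤ x * (x * x) := mul_le_mul' le_rfl (mul_le_mul' h h)
    rw [hcube] at hle
    exact le_antisymm hle h

/-- **The parity source**: `v₃(λ)² = v₃(3)`. [folklore] -/
theorem val3_lam_sq : v3.valuation K3 lam ^ 2 = v3.valuation K3 3 := by
  rw [← map_pow, lam_sq, show (-3 : K3) * zeta3 = -(3 * zeta3) by ring, Valuation.map_neg,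
    map_mul, val3_zeta, mul_one]

/-- `v₃(3) < 1`. [folklore] -/
theorem val3_three_lt_one : v3.valuation K3 3 < 1 := by
  rw [← val3_lam_sq, pow_two]
  calc v3.valuation K3 lam * v3.valuation K3 lam
      ≤ 1 * v3.valuation K3 lam := mul_le_mul' val3_lam_lt_one.le le_rfl
    _ = v3.valuation K3 lam := one_mul _
    _ < 1 := val3_lam_lt_one

/-- `v₃(3) ≠ 0`. [folklore] -/
theorem val3_three_ne_zero : v3.valuation K3 3 ≠ 0 := val3_ne_zero (by norm_num)

/-- `3 = −λ²ζ₃²` at the integer level. [folklore] -/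
theorem three_eq_lamInt : (3 : 𝓞 K3) = -(lamInt ^ 2) * zetaInt ^ 2 := by
  apply RingOfIntegers.coe_injective
  show algebraMap (𝓞 K3) K3 3 = algebraMap (𝓞 K3) K3 (-(lamInt ^ 2) * zetaInt ^ 2)
  rw [map_mul, map_neg, map_pow, map_pow, algebraMap_lamInt,
    show algebraMap (𝓞 K3) K3 zetaInt = zeta3 from rfl, map_ofNat]
  exact three_eq_lam

/-- `λ ∣ 3` in `𝒪_{K₃}`. [folklore] -/
theorem lamInt_dvd_three : lamInt ∣ (3 : 𝓞 K3) :=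
  ⟨-(lamInt * zetaInt ^ 2), by rw [three_eq_lamInt]; ring⟩

/-- **`v₃(n) = 1` for integers prime to `3`.** [folklore] -/
theorem val3_intCast_eq_one {n : ℤ} (hn : ¬(3 : ℤ) ∣ n) : v3.valuation K3 (n : K3) = 1 := by
  have hcoe : (n : K3) = algebraMap (𝓞 K3) K3 (n : 𝓞 K3) := by
    rw [map_intCast]
  rw [hcoe, valuation_of_algebraMap, intValuation_eq_one_iff_mem_primeCompl]
  show (n : 𝓞 K3) ∉ v3.asIdeal
  intro hmem
  rw [show v3.asIdeal = Ideal.span {lamInt} from rfl, Ideal.mem_span_singleton] at hmem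
  -- Bezout, by hand: `n % 3 ∈ {1, 2}` gives explicit coefficients
  have hbez : ∃ u w : ℤ, u * 3 + w * n = 1 := by
    have h1 : n % 3 = 1 ∨ n % 3 = 2 := by omega
    rcases h1 with h | h
    · exact ⟨-(n / 3), 1, by omega⟩
    · exact ⟨-(2 * (n / 3) + 1), 2, by omega⟩
  obtain ⟨u, w, huw⟩ := hbez
  have hdvd1 : lamInt ∣ (1 : 𝓞 K3) := by
    have h1 : ((u * 3 + w * n : ℤ) : 𝓞 K3) = 1 := by rw [huw]; exact Int.cast_one
    rw [← h1]
    push_cast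
    exact dvd_add (Dvd.dvd.mul_left lamInt_dvd_three _) (Dvd.dvd.mul_left hmem _)
  exact lamInt_prime.not_unit (isUnit_of_dvd_one hdvd1)

/-- `v₃` of a nonzero natural number is a power of `v₃(3)`. [folklore] -/
theorem val3_natCast_exists {m : ℕ} (hm : m ≠ 0) :
    ∃ k : ℕ, v3.valuation K3 (m : K3) = v3.valuation K3 3 ^ k := by
  obtain ⟨k, u, hu, rfl⟩ := Nat.exists_eq_pow_mul_and_not_dvd hm 3 (by norm_num)
  refine ⟨k, ?_⟩
  push_cast
  rw [map_mul, map_pow, ← Int.cast_natCast (R := K3) u,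
    val3_intCast_eq_one (by exact_mod_cast hu), mul_one]

/-- `v₃` of a nonzero integer is a power of `v₃(3)`. [folklore] -/
theorem val3_intCast_exists {n : ℤ} (hn : n ≠ 0) :
    ∃ k : ℕ, v3.valuation K3 (n : K3) = v3.valuation K3 3 ^ k := by
  rcases le_total 0 n with hpos | hneg
  · lift n to ℕ using hpos
    rw [Int.cast_natCast]
    exact val3_natCast_exists (by exact_mod_cast hn)
  · obtain ⟨m, hm⟩ : ∃ m : ℕ, n = -(m : ℤ) :=
      ⟨(-n).toNat, by omega⟩
    have hm0 : m ≠ 0 := by omega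
    have hcast : (n : K3) = -((m : ℕ) : K3) := by
      rw [hm]
      push_cast
      ring
    rw [hcast, Valuation.map_neg]
    exact val3_natCast_exists hm0

/-- **`v₃` of a nonzero rational is an integer power of `v₃(3)`.** [folklore] -/
theorem val3_ratCast_exists (q : ℚ) (hq : q ≠ 0) :
    ∃ k : ℤ, v3.valuation K3 (q : K3) = v3.valuation K3 3 ^ k := by
  obtain ⟨m1, h1⟩ := val3_intCast_exists (Rat.num_ne_zero.mpr hq)
  obtain ⟨m2, h2⟩ := val3_natCast_exists q.den_nz
  refine ⟨(m1 : ℤ) - m2, ?_⟩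
  rw [Rat.cast_def, map_div₀, h1, h2, ← zpow_natCast (v3.valuation K3 3) m1,
    ← zpow_natCast (v3.valuation K3 3) m2, ← zpow_sub₀ val3_three_ne_zero]

/-- Positive powers of `v₃(3)` are `< 1`. [folklore] -/
theorem val3_three_pow_lt_one {m : ℕ} (hm : m ≠ 0) : v3.valuation K3 3 ^ m < 1 := by
  obtain ⟨m', rfl⟩ := Nat.exists_eq_succ_of_ne_zero hm
  calc v3.valuation K3 3 ^ (m' + 1) = v3.valuation K3 3 ^ m' * v3.valuation K3 3 := pow_succ _ _
    _ ≤ 1 * v3.valuation K3 3 := mul_le_mul' (pow_le_one' val3_three_lt_one.le m') le_rfl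
    _ = v3.valuation K3 3 := one_mul _
    _ < 1 := val3_three_lt_one

/-- `v₃(3)^j = 1` only for `j = 0`. [folklore] -/
theorem val3_three_zpow_eq_one_iff (j : ℤ) : v3.valuation K3 3 ^ j = 1 ↔ j = 0 := by
  constructor
  · intro hj
    by_contra hj0
    rcases lt_trichotomy j 0 with hneg | hz | hpos
    · have hjn : v3.valuation K3 3 ^ (-j) = 1 := by
        rw [zpow_neg, hj, inv_one]
      have hnat : v3.valuation K3 3 ^ ((-j).toNat) = 1 := by
        rw [← hjn, ← zpow_natCast, Int.toNat_of_nonneg (by omega)]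
      exact absurd hnat
        (ne_of_lt (val3_three_pow_lt_one (by omega)))
    · exact hj0 hz
    · have hnat : v3.valuation K3 3 ^ (j.toNat) = 1 := by
        rw [← hj, ← zpow_natCast, Int.toNat_of_nonneg (by omega)]
      exact absurd hnat
        (ne_of_lt (val3_three_pow_lt_one (by omega)))
  · rintro rfl
    exact zpow_zero _

/-- **The parity lemma**: `v₃(λ)` is the valuation of NO rational number — `v₃(λ)` is an odd
power of the half-integral uniformizer scale while rationals occupy the even powers. This is
exactly where ramification enters. [folklore] -/
theorem val3_ratCast_ne_val3_lam (q : ℚ) : v3.valuation K3 (q : K3) ≠ v3.valuation K3 lam := by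
  rcases eq_or_ne q 0 with rfl | hq
  · rw [Rat.cast_zero, map_zero]
    exact fun h => val3_ne_zero lam_ne_zero h.symm
  · intro hEq
    obtain ⟨k, hk⟩ := val3_ratCast_exists q hq
    have h2 : v3.valuation K3 3 ^ (2 * k) = v3.valuation K3 3 ^ (1 : ℤ) := by
      have hsq : (v3.valuation K3 3 ^ k) ^ (2 : ℕ) = v3.valuation K3 3 := by
        rw [← hk, hEq]
        exact val3_lam_sq
      have hmul : (2 * k : ℤ) = k * ((2 : ℕ) : ℤ) := by push_cast; ring
      calc v3.valuation K3 3 ^ (2 * k)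
          = (v3.valuation K3 3 ^ k) ^ ((2 : ℕ) : ℤ) := by rw [hmul, zpow_mul]
        _ = (v3.valuation K3 3 ^ k) ^ (2 : ℕ) := by rw [zpow_natCast]
        _ = v3.valuation K3 3 := hsq
        _ = v3.valuation K3 3 ^ (1 : ℤ) := (zpow_one _).symm
    have h3 : v3.valuation K3 3 ^ (2 * k - 1) = 1 := by
      rw [zpow_sub₀ val3_three_ne_zero, h2, div_self (zpow_ne_zero _ val3_three_ne_zero)]
    rw [val3_three_zpow_eq_one_iff] at h3
    omega

/-! ## 4. The ultrametric max formula and the boundedness of the swap -/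

/-- The ultrametric max formula in the `{1, λ}` coordinates: the two summands always have
DISTINCT valuations (parity), so the valuation of the sum is their max. [folklore] -/
theorem val3_add_eq_max (p q : ℚ) :
    v3.valuation K3 ((p : K3) + q • lam) =
      max (v3.valuation K3 (p : K3)) (v3.valuation K3 (q • lam)) := by
  rcases eq_or_ne p 0 with rfl | hp
  · rw [Rat.cast_zero, zero_add, map_zero]
    first
      | exact (max_eq_right (zero_le _)).symm
      | exact (max_eq_right zero_le).symm
  rcases eq_or_ne q 0 with rfl | hq
  · rw [zero_smul, add_zero, map_zero]
    first
      | exact (max_eq_left (zero_le _)).symm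
      | exact (max_eq_left zero_le).symm
  have hne : v3.valuation K3 (p : K3) ≠ v3.valuation K3 (q • lam) := by
    rw [ratCast_smul_eq, map_mul]
    intro hEq
    have hqK : (q : K3) ≠ 0 := by exact_mod_cast hq
    have h1 : v3.valuation K3 ((p / q : ℚ) : K3) = v3.valuation K3 lam := by
      push_cast
      rw [map_div₀, hEq, mul_comm, mul_div_assoc, div_self (val3_ne_zero hqK), mul_one]
    exact val3_ratCast_ne_val3_lam (p / q) h1
  exact (v3.valuation K3).map_add_of_distinct_val hne

/-- `v₃(q·λ) = v₃(q)·v₃(λ)`. [folklore] -/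
theorem val3_smul_lam (q : ℚ) :
    v3.valuation K3 (q • lam) = v3.valuation K3 (q : K3) * v3.valuation K3 lam := by
  rw [ratCast_smul_eq, map_mul]

/-- **The kit's boundedness hypothesis**: the swap moves valuations by at most one `λ`:
`v₃(λ)·v₃(s x) ≤ v₃(x)`. [folklore] -/
theorem val3_bound (x : K3) :
    v3.valuation K3 lam * v3.valuation K3 (sSwap x) ≤ v3.valuation K3 x := by
  have hx : v3.valuation K3 x =
      max (v3.valuation K3 ((coordA x : ℚ) : K3)) (v3.valuation K3 (coordB x • lam)) := by
    conv_lhs => rw [eq_combo x]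
    exact val3_add_eq_max _ _
  have hsx : v3.valuation K3 (sSwap x) =
      max (v3.valuation K3 ((coordB x : ℚ) : K3)) (v3.valuation K3 (coordA x • lam)) := by
    conv_lhs => rw [eq_combo x, sSwap_combo]
    exact val3_add_eq_max _ _
  rw [hsx]
  rcases max_cases (v3.valuation K3 ((coordB x : ℚ) : K3))
    (v3.valuation K3 (coordA x • lam)) with ⟨hm, _⟩ | ⟨hm, _⟩
  · -- the max is v(B): v(λ)·v(B) = v(B·λ) ≤ v(x)
    rw [hm, mul_comm, ← val3_smul_lam]
    rw [hx]
    exact le_max_right _ _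
  · -- the max is v(A·λ): v(λ)·v(A)·v(λ) = v(A)·v(λ)² ≤ v(A) ≤ v(x)
    rw [hm, val3_smul_lam]
    calc v3.valuation K3 lam * (v3.valuation K3 ((coordA x : ℚ) : K3) * v3.valuation K3 lam)
        = v3.valuation K3 ((coordA x : ℚ) : K3) *
            (v3.valuation K3 lam * v3.valuation K3 lam) := by
          rw [mul_comm (v3.valuation K3 lam), mul_assoc]
      _ ≤ v3.valuation K3 ((coordA x : ℚ) : K3) * 1 :=
          mul_le_mul' le_rfl (mul_le_one' val3_lam_lt_one.le val3_lam_lt_one.le)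
      _ = v3.valuation K3 ((coordA x : ℚ) : K3) := mul_one _
      _ ≤ v3.valuation K3 x := by rw [hx]; exact le_max_left _ _

/-! ## 5. The swap preserves the integer lattice `𝒪_{K₃} = ℤ ⊕ ℤλ` -/

/-- Members of `ℤ[ζ₃]` have integer `ζ`-coordinates. [folklore] -/
theorem exists_int_coords_of_mem_adjoin {x : K3}
    (hx : x ∈ Algebra.adjoin ℤ ({zeta3} : Set K3)) :
    ∃ a b : ℤ, x = (a : K3) + (b : K3) * zeta3 := by
  induction hx using Algebra.adjoin_induction with
  | mem y hy =>
    rcases hy with rfl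
    exact ⟨0, 1, by push_cast; ring⟩
  | algebraMap n =>
    exact ⟨n, 0, by push_cast; simp⟩
  | add xx yy _ _ ihx ihy =>
    obtain ⟨a, b, rfl⟩ := ihx
    obtain ⟨a', b', rfl⟩ := ihy
    exact ⟨a + a', b + b', by push_cast; ring⟩
  | mul xx yy _ _ ihx ihy =>
    obtain ⟨a, b, rfl⟩ := ihx
    obtain ⟨a', b', rfl⟩ := ihy
    refine ⟨a * a' - b * b', a * b' + b * a' - b * b', ?_⟩
    push_cast
    linear_combination ((b : K3) * (b' : K3)) * zeta3_sq_add

/-- Every algebraic integer of `K₃` lies in `ℤ[ζ₃]` (Mathlib: `𝓞 K₃` is the integral closure,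
and `ℤ[ζ₃]` is integrally closed for the prime `3`). [folklore] -/
theorem ringOfIntegers_mem_adjoin (r : 𝓞 K3) :
    algebraMap (𝓞 K3) K3 r ∈ Algebra.adjoin ℤ ({zeta3} : Set K3) := by
  haveI : Fact (Nat.Prime 3) := ⟨by norm_num⟩
  haveI := cycInst
  haveI hic : IsIntegralClosure (Algebra.adjoin ℤ ({zeta3} : Set K3)) ℤ K3 :=
    IsCyclotomicExtension.Rat.isIntegralClosure_adjoin_singleton_of_prime zeta3_spec
  obtain ⟨y, hy⟩ := hic.isIntegral_iff.mp (RingOfIntegers.isIntegral_coe r)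
  rw [← hy]
  exact y.2

/-- **Integer `λ`-coordinates**: every algebraic integer is `a + bλ` with `a, b ∈ ℤ`.
[folklore] -/
theorem exists_int_coords (r : 𝓞 K3) :
    ∃ a b : ℤ, algebraMap (𝓞 K3) K3 r = (a : K3) + (b : ℚ) • lam := by
  obtain ⟨a, b, hab⟩ := exists_int_coords_of_mem_adjoin (ringOfIntegers_mem_adjoin r)
  refine ⟨a + b, b, ?_⟩
  rw [hab, ratCast_smul_eq]
  simp only [lam]
  push_cast
  ring

/-- **The swap preserves the integer lattice**: `s` maps the image of `𝒪_{K₃}` into itself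
(`s(a + bλ) = b + aλ`). [folklore] -/
theorem sSwap_image_int (r : 𝓞 K3) :
    ∃ r' : 𝓞 K3, sSwap (algebraMap (𝓞 K3) K3 r) = algebraMap (𝓞 K3) K3 r' := by
  obtain ⟨a, b, hab⟩ := exists_int_coords r
  refine ⟨(b : 𝓞 K3) + (a : 𝓞 K3) * lamInt, ?_⟩
  have h1 : ((a : ℚ) : K3) = (a : K3) := by push_cast; rfl
  rw [hab, show (a : K3) = ((a : ℚ) : K3) from h1.symm, sSwap_combo, map_add, map_mul,
    map_intCast, map_intCast, algebraMap_lamInt, ratCast_smul_eq]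
  push_cast
  ring

end Summit.ABC.IUTFork.RamifiedMover

end
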